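import Summits.ABC.IUTFork.Repair.RH2SigmaHullRecutRow16
import Summits.ABC.IUTFork.Conditional.AbcOfSHwindowFreyRefutationHolds
import HarnessLib

/-!
# R-H ROUND 2, Q2 hull-reach family (rows 15 ⊋ 8, 16, 18): the Σ-BINDERS of this seat's window-shape re-cut certificates are KERNEL-FALSE —
# every genuine Θ-volume datum over the tier-1 Frey–Legendre point `(ratPoint λ, 13)`, `λ = 2·5¹⁰·13⁴/(11⁸·109²·3677³)`, lies OFF Σ₁₅, Σ₈, Σ₁₈, Σ₁₆,
# so «every shallow admissible datum of a Szpiro-bad point lies in Σ_row» (`hSigma15Bad` / `hSigma8Bad` / `hSigma18Bad` / `hSigma16Bad` /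
# `hInSigma16Bad` of p475597 / p476057 / p476262) fails — UNCONDITIONALLY, no context binder, no hypothesis

PROOF-ONLY file (D-0012: 0 definitions, 0 `Prop` facts, no instance, no notation; abc-iut cell, rung LADDER-ABC:A2.RESCUE.H; seat abc-iut-rh2-q2-hull gen 3),
answering referee abc-iut-rp-m1 (gen 7)'s KERNEL CAVEAT of 2026-08-27T00:11:22Z on p475597 theorems 2–3 / p476057 — concurring kernel probe: abc-iut-rp-m1 gen 8,
`HOME/plan/repair/m1/audit-g8/ProbeSigmaBinderVacuity.lean` sha16 2450c2b258aed9c2 (rc 0, std3; context-family form); rh-lead ruling R16 / R14-bis 2026-08-27T01:00:25Z.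
TAKES NO SIDE on [IUTchIII] Cor. 3.12 or on any author; refuted here: a datum-class MEMBERSHIP binder of this seat's OWN certificates; refuted-as-typed ≠ refuted-in-print.
THE CAVEAT. The window-shape re-cuts `abc_of_inSigma_v10K_window_szpiroBadAll` (GENERIC) / `abc_of_sigma15_…` (p475597), `abc_of_hBand_…` / `abc_of_inSigma18_…`
/ `abc_of_sigma16_…` (p476057), `abc_of_inSigma16_…` (p476262) carry the STRATUM binder «at every Szpiro-bad admissible `(P, l)`, every genuine datum OFF the
degree-form depth locus lies in Σ_row» and feed it through this seat's DOOR (Σ_row ⟹ the hull clause S_H at the certificates' bed) into the `hSHwBad` slot of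
`Conditional.abc_of_SH_v10K_window_szpiroBadAll` (p453137). rp-m1: `hSHwBad` is refuted MODULO (P6) at the tier-1 Frey–Legendre datum (`Conditional.not_hSHwBad_frey`);
since then (P6) there LANDED (`Conditional.condP6_thirteen` p476875, `Conditional.not_hSHwBad_frey_holds` p477209), so the disease is UNCONDITIONAL — the class of
`Conditional.not_hreg_v4`, one binder over. THIS file puts it in the kernel with NO context binder in any statement (the column data `M … qK` are instantiated
at a trivial family INSIDE the proofs):
* §1 `frey13_not_of_door` — at every genuine datum `T` over `(ratPoint λ, 13)`, a proposition with a DOOR to the hull clause at `T`'s bed (for every column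
  family — the shape of all four doors) is FALSE: abc-iut-w5-d107's UNCONDITIONAL `GenuineK.not_pilotKummerCompatHull_chosen_triple_3677_thirteen` (robust
  tame-exact decider, `p = 3677`, `v = 3`, label `j = 6`) at the trivial column family; then `frey13_not_inSigma15` / `_not_hBand` / `_not_inSigma18` /
  `_not_hside_hStarDiffPriced` / `_not_inSigma16`: EVERY genuine datum over `(ratPoint λ, 13)` is OFF Σ₁₅, Σ₈, Σ₁₈, Σ₁₆ (both typings).
* §2 `not_hSigmaBad_of_forall_not_frey13` — GENERIC: for ANY datum class `InSig` missing every genuine datum over `(ratPoint λ, 13)`, the stratum binder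
  `hSigmaBad` (TYPE VERBATIM) is FALSE: `(ratPoint λ, 13)` is admissible (`FreyTier1.mem_UP/.admitsCore/.condP2/.condP5`, `condP6_thirteen`) and Szpiro-bad AS
  TYPED (`FreyTier1.szpiroBad`), every genuine datum over it is shallow (`FreyTier1.not_deep`), the datum type is inhabited. Pure logic on landed theorems.
* §3 `not_hSigma15Bad` / `not_hSigma8Bad` / `not_hSigma18Bad` / `not_hSigma16Bad` / `not_hInSigma16Bad` — the five Σ-binders, TYPES VERBATIM from p475597 / p476057 / p476262, are FALSE.
READING (numbers, no side). The six window-shape re-cuts are kernel-true implications with a kernel-false antecedent: VACUOUS AS TYPED (records; docstring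
warnings by the docstring-only protocol). Successor shape: p475597 §1 `abc_of_inSigma_orNum_K_szpiroBad_hregBad` (explicit 2 = NUM-OFF-Σ(Szpiro-bad) ·
CONE(Szpiro-bad); C-R39 (3) precedent; rh-lead's «hregBad socket» 2026-08-27T00:25:42Z): its off-Σ binder asks the NUMBER-level `T.Cor312Of` — ENGAGED at
`(ratPoint λ, 13)` by §1 (it demands `Cor22.Cor312AtDatum (ratPoint λ) 13` there) and neither proved nor refuted as typed anywhere in the tree.
HONEST SCOPE: SHARP reading of the hull clause (typed (Ind1)/(Ind2)); the per-label licence is a STRONGER-THAN-PRINT sufficient form of (xi-f); Σ₁₅/Σ₈/Σ₁₈/Σ₁₆ are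
this cell's OWN candidate repairs, not anything in print; nothing here bears on the printed GLOBAL inequality, the number-level Corollary, or any author's intended
hull; typed ≠ proved; instantiated ≠ endorsed. [cite: Mochizuki2012, IUTchIII Cor. 3.12 p. 173–174, Step (xi-f) p. 184; IUTchIV Thm. 1.10 p. 22–23, Cor. 2.2 (ii)
proof (P2)(P5)(P6)(P7) p. 43–46] [cite: DupuyHilado2025, §3.4, §3.9, §4.9] [claim: Mochizuki2012, status: disputed] for every IUT quotation.
-/

noncomputable section
open Set Function
namespace Summit.ABC.IUTFork.Repair.RH2SigmaHull

open Thm311 Thm311.Real Cor312 Cor312.Setting Cor312Vol Cor312Prov Literature.IUT.LogThetaLattice Literature.IUT.LogVolume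
  Literature.IUT.HodgeTheaters Literature.IUT.LogVolume.ThetaData
open Literature.NumberTheory.NumberFields NumberField IsDedekindDomain Metric RHSlotReach RH RH.InSigmaDatum
open Literature.NumberTheory.DiophantineGeometry Literature.NumberTheory.DiophantineGeometry.GenEll Summit.ABC.ABC.Theorems

/-! ## §1. Every genuine Θ-volume datum over the tier-1 Frey–Legendre point `(ratPoint λ, 13)` is OFF Σ₁₅, Σ₈, Σ₁₈, Σ₁₆ -/

/-- **At a genuine datum over `(ratPoint λ, 13)`, a proposition with a DOOR to the hull clause is FALSE.** If `C` implies, for EVERY family of the column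
binders `M, archPk, …, qK`, the hull clause at the bed of `T` (chosen realising ideles, analytic logarithms, SHARP boxes — the body of `hSHw`/`hSHwBad` at `T`;
the shape of this seat's four doors), then `¬ C`: abc-iut-w5-d107's UNCONDITIONAL `GenuineK.not_pilotKummerCompatHull_chosen_triple_3677_thirteen` at the
TRIVIAL column family (`M = ℚ`, empty sets, zero divisors, one-point LGP signature / monoids). [cite: Mochizuki2012, IUTchIII Cor. 3.12 Step (xi-f) p. 184] [claim: Mochizuki2012, status: disputed] -/
theorem frey13_not_of_door
    (T : Cor22.ThetaVolumeDatumAt (ratPoint (((2 * 5 ^ 10 * 13 ^ 4 : ℕ) : ℚ) / (11 ^ 8 * 109 ^ 2 * 3677 ^ 3 : ℕ))) 13) {C : Prop}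
    (hdoor : letI := T.instFieldF; letI := T.instNumberFieldF; letI := T.instAlgebraF; letI := T.instFieldK
      letI := T.instNumberFieldK; letI := T.instAlgebraK; letI := T.instFieldFbar; letI := T.instAlgebraFbar
      letI := T.instAlgebraKFbar; letI := T.instIsElliptic
      ∀ (M : Type) [Field M] [NumberField M]
      (archPk : ∀ (j : (thetaIndex (pilotDataOfK T.D T.K)).Label) (vQ : (thetaIndex (pilotDataOfK T.D T.K)).VQ),
        Set ((logShellsDH (pilotDataOfK T.D T.K) (analyticLogv T.K)).Packet j vQ))
      (archSub : ∀ (j : (thetaIndex (pilotDataOfK T.D T.K)).Label) (v : (thetaIndex (pilotDataOfK T.D T.K)).V),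
        Set ((logShellsDH (pilotDataOfK T.D T.K) (analyticLogv T.K)).Packet j ((thetaIndex (pilotDataOfK T.D T.K)).over v)))
      (Ψ : ℤ → ∀ v : (thetaIndex (pilotDataOfK T.D T.K)).V, v ∈ (thetaIndex (pilotDataOfK T.D T.K)).Vbad →
        Set ((logShellsDH (pilotDataOfK T.D T.K) (analyticLogv T.K)).StarPacket v))
      (act : ℤ → ∀ v : (thetaIndex (pilotDataOfK T.D T.K)).V, v ∈ (thetaIndex (pilotDataOfK T.D T.K)).Vbad →
        (logShellsDH (pilotDataOfK T.D T.K) (analyticLogv T.K)).StarPacket v →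
          Module.End ℚ ((logShellsDH (pilotDataOfK T.D T.K) (analyticLogv T.K)).StarPacket v))
      (Mmod : ℤ → ∀ j : (thetaIndex (pilotDataOfK T.D T.K)).LabelStar, Set ((logShellsDH (pilotDataOfK T.D T.K) (analyticLogv T.K)).GlobalPacket j.1))
      (region : ℤ → ∀ j : (thetaIndex (pilotDataOfK T.D T.K)).LabelStar, FinDivisor M → ∀ vQ : (thetaIndex (pilotDataOfK T.D T.K)).VQ,
        Set ((logShellsDH (pilotDataOfK T.D T.K) (analyticLogv T.K)).Packet j.1 vQ))
      (frobAdm : ℤ → ℤ → ∀ (j : (thetaIndex (pilotDataOfK T.D T.K)).Label) (vQ : (thetaIndex (pilotDataOfK T.D T.K)).VQ),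
        Set ((logShellsDH (pilotDataOfK T.D T.K) (analyticLogv T.K)).Packet j vQ) → Prop)
      (frobLogvol : ℤ → ℤ → ∀ (j : (thetaIndex (pilotDataOfK T.D T.K)).Label) (vQ : (thetaIndex (pilotDataOfK T.D T.K)).VQ),
        Set ((logShellsDH (pilotDataOfK T.D T.K) (analyticLogv T.K)).Packet j vQ) → ℝ)
      (frobΨ : ℤ → ℤ → ∀ v : (thetaIndex (pilotDataOfK T.D T.K)).V, v ∈ (thetaIndex (pilotDataOfK T.D T.K)).Vbad →
        Set ((logShellsDH (pilotDataOfK T.D T.K) (analyticLogv T.K)).StarPacket v))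
      (frobMmod : ℤ → ℤ → ∀ j : (thetaIndex (pilotDataOfK T.D T.K)).LabelStar, Set ((logShellsDH (pilotDataOfK T.D T.K) (analyticLogv T.K)).GlobalPacket j.1))
      (unitImage : ℤ → ℤ → ℕ → ∀ (j : (thetaIndex (pilotDataOfK T.D T.K)).Label) (vQ : (thetaIndex (pilotDataOfK T.D T.K)).VQ),
        Set ((logShellsDH (pilotDataOfK T.D T.K) (analyticLogv T.K)).Packet j vQ))
      (ballImage : ℤ → ℤ → ∀ (j : (thetaIndex (pilotDataOfK T.D T.K)).Label) (vQ : (thetaIndex (pilotDataOfK T.D T.K)).VQ),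
        Set ((logShellsDH (pilotDataOfK T.D T.K) (analyticLogv T.K)).Packet j vQ))
      (thetaDiv : ℤ → ℤ → LgpDivisor M (thetaIndex (pilotDataOfK T.D T.K)).lstar)
      (n : ℤ) {HT : Type} {LogLink : HT → HT → Type} {IsFull : ∀ {s t : HT}, LogLink s t → Prop}
      (lat : LGPGaussianLogThetaLattice LogLink IsFull)
      {Frd : Type} {IsoF : Frd → Frd → Type} {Ob : Frd → Type} {realify : Frd → Frd} {Strip : Type}
      {IsoS : Strip → Strip → Type} {Mv : ∀ v : (thetaIndex (pilotDataOfK T.D T.K)).V, v ∈ (thetaIndex (pilotDataOfK T.D T.K)).Vbad → Type}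
      [∀ v h, Monoid (Mv v h)]
      (sig : GlobalLGPFrobenioidSignature (thetaIndex (pilotDataOfK T.D T.K)).lstar (thetaIndex (pilotDataOfK T.D T.K)).V
        (· ∈ (thetaIndex (pilotDataOfK T.D T.K)).Vbad) Frd IsoF Ob realify Strip IsoS Mv)
      (split : SplittingMonoids Mv) {ObΔ : Type} {N : ∀ v : (thetaIndex (pilotDataOfK T.D T.K)).V, v ∈ (thetaIndex (pilotDataOfK T.D T.K)).Vbad → Type}
      [∀ v h, Monoid (N v h)] (qData : QPilotData ObΔ N)
      (qK : ∀ v : (thetaIndex (pilotDataOfK T.D T.K)).V, v ∈ (thetaIndex (pilotDataOfK T.D T.K)).Vbad →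
        Set ((logShellsDH (pilotDataOfK T.D T.K) (analyticLogv T.K)).StarPacket v)),
      C → Cor312Vol.PilotKummerCompatHull
          (LatticeSituation.ofShells (logShellsDH (pilotDataOfK T.D T.K) (analyticLogv T.K)) M archPk archSub
            (summandPiecesPr (pilotDataOfK T.D T.K) (logvAnalytic_analyticLogv (F := T.K))).Adm
            (summandPiecesPr (pilotDataOfK T.D T.K) (logvAnalytic_analyticLogv (F := T.K))).logvol Ψ act Mmod region frobAdm frobLogvol frobΨ
            frobMmod unitImage ballImage thetaDiv)
          (settingPrVolSharp (pilotDataOfK T.D T.K) (logvAnalytic_analyticLogv (F := T.K)) M archPk archSub Ψ act Mmod region n lat sig split qData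
            (exists_realising_qIdeles_pilotDataOfK T.D).choose (exists_realising_thetaIdeles_pilotDataOfK T.D).choose
            (exists_realising_qIdeles_pilotDataOfK T.D).choose_spec.1 (exists_realising_qIdeles_pilotDataOfK T.D).choose_spec.2.1)
          (fun _ => Cor312.Setting.qRegion
            (settingPrVolSharp (pilotDataOfK T.D T.K) (logvAnalytic_analyticLogv (F := T.K)) M archPk archSub Ψ act Mmod region n lat sig split qData
              (exists_realising_qIdeles_pilotDataOfK T.D).choose (exists_realising_thetaIdeles_pilotDataOfK T.D).choose
              (exists_realising_qIdeles_pilotDataOfK T.D).choose_spec.1 (exists_realising_qIdeles_pilotDataOfK T.D).choose_spec.2.1)) qK) :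
    ¬ C := by
  letI := T.instFieldF; letI := T.instNumberFieldF; letI := T.instAlgebraF; letI := T.instFieldK
  letI := T.instNumberFieldK; letI := T.instAlgebraK; letI := T.instFieldFbar; letI := T.instAlgebraFbar
  letI := T.instAlgebraKFbar; letI := T.instIsElliptic
  intro hC
  -- the trivial column family: `M = ℚ`, empty sets, zero divisors, the one-point signature / splitting monoids / q-pilot data
  refine Conditional.GenuineK.not_pilotKummerCompatHull_chosen_triple_3677_thirteen T ℚ (fun _ _ => ∅) (fun _ _ => ∅) (fun _ _ _ => ∅)
    (fun _ _ _ _ => 0) (fun _ _ => ∅) (fun _ _ _ _ => ∅) (fun _ _ _ _ _ => True) (fun _ _ _ _ _ => 0) (fun _ _ _ _ => ∅) (fun _ _ _ => ∅)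
    (fun _ _ _ _ _ => ∅) (fun _ _ _ _ => ∅) (fun _ _ _ => 0) 0 (HT := ℤ × ℤ) (LogLink := fun _ _ => Unit) (IsFull := fun _ => True)
    ⟨fun a b => (a, b), fun p q h => by simpa [Prod.ext_iff] using h, fun _ _ => (), fun _ _ => trivial⟩
    (Frd := Unit) (IsoF := fun _ _ => Unit) (Ob := fun _ => Unit) (realify := id) (Strip := Unit) (IsoS := fun _ _ => Unit)
    (Mv := fun _ _ => Unit)
    { FMOD := fun _ => (), Fmod := fun _ => (), Ffrak := fun _ => (), isoModMOD := fun _ => (), isoModFrak := fun _ => (),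
      isoFrakMOD := fun _ => (), CLGP := (), Clgp := (), FLGP := (), Flgp := (), Fgau := (), isoGauLGP := (), isoLGPlgp := (),
      isoCLGPlgp := (), embLGP := fun _ _ => (), embLgp := fun _ _ => (), embLGP_injective := fun _ _ _ => Subsingleton.elim _ _,
      embLgp_injective := fun _ _ _ => Subsingleton.elim _ _, objOfLgp := fun _ => (), objOfLGP := fun _ => (),
      objOfFrak := fun _ _ => (), objOfMOD := fun _ _ => () }
    ⟨fun _ _ => ⊤, fun _ _ => ⟨1, fun x => ⟨1, 1, 0, Nat.one_pos, one_pow 1, Subsingleton.elim _ _⟩⟩⟩ (ObΔ := Unit) (N := fun _ _ => Unit)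
    ⟨fun _ _ => (), fun _ _ x => ⟨1, 1, 0, Nat.one_pos, one_pow 1, Subsingleton.elim _ _⟩, fun _ => ()⟩ (fun _ _ => ∅) ?_
  exact hdoor ℚ _ _ _ _ _ _ _ _ _ _ _ _ _ _ _ _ _ _ _ hC

/-- **OFF Σ₁₅**: no genuine datum over `(ratPoint λ, 13)` carries a certified slot-reach window dictionary `(n₀, λ, m_q)` — the conclusion of `hSigma15Bad`
(p475597) at `T`, VERBATIM; door p469830 `pilotKummerCompatHull_chosen_of_slotReachWindowK`. [cite: DupuyHilado2025, §3.9, §4.9] [claim: Mochizuki2012, status: disputed] -/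
theorem frey13_not_inSigma15
    (T : Cor22.ThetaVolumeDatumAt (ratPoint (((2 * 5 ^ 10 * 13 ^ 4 : ℕ) : ℚ) / (11 ^ 8 * 109 ^ 2 * 3677 ^ 3 : ℕ))) 13) :
    letI := T.instFieldF; letI := T.instNumberFieldF; letI := T.instAlgebraF; letI := T.instFieldK
    letI := T.instNumberFieldK; letI := T.instAlgebraK; letI := T.instFieldFbar; letI := T.instAlgebraFbar
    letI := T.instAlgebraKFbar; letI := T.instIsElliptic
    ¬ (∃ (n₀ : ∀ pp : Nat.Primes, (thetaIndex (pilotDataOfK T.D T.K)).Fibre (.inr pp) → ℕ)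
        (lam : ∀ pp : Nat.Primes, (thetaIndex (pilotDataOfK T.D T.K)).Fibre (.inr pp) → ℝ)
        (mq : ∀ pp : Nat.Primes, (thetaIndex (pilotDataOfK T.D T.K)).Fibre (.inr pp) → ℤ),
        (∀ (pp : Nat.Primes) (x : (thetaIndex (pilotDataOfK T.D T.K)).Fibre (.inr pp)), haveI : Fact (pp : ℕ).Prime := ⟨pp.2⟩;
          ∃ u : kOf (pilotDataOfK T.D T.K) pp.1 x,
            ‖u‖ ≤ (pp : ℝ) ^ (-(((n₀ pp x : ℤ) - 1 : ℤ) : ℝ) / (ramIdx T.K (placeOf (pilotDataOfK T.D T.K) pp.1 x) : ℝ)) ∧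
              u ∉ (logUnits (kOf (pilotDataOfK T.D T.K) pp.1 x) : Set (kOf (pilotDataOfK T.D T.K) pp.1 x))) ∧
        (∀ (pp : Nat.Primes) (x : (thetaIndex (pilotDataOfK T.D T.K)).Fibre (.inr pp)), haveI : Fact (pp : ℕ).Prime := ⟨pp.2⟩;
          ∃ z ∈ (logUnits (kOf (pilotDataOfK T.D T.K) pp.1 x) : Set (kOf (pilotDataOfK T.D T.K) pp.1 x)), (pp : ℝ) ^ (lam pp x) ≤ ‖z‖) ∧
        (∀ (pp : Nat.Primes) (w : (thetaIndex (pilotDataOfK T.D T.K)).Fibre (.inr pp)), haveI : Fact (pp : ℕ).Prime := ⟨pp.2⟩;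
          placeOf (pilotDataOfK T.D T.K) pp.1 w ∈ (pilotDataOfK T.D T.K).S →
            (mq pp w : ℝ) = (pilotDataOfK T.D T.K).qPilot (placeOf (pilotDataOfK T.D T.K) pp.1 w)) ∧
        SlotReachWindowK T.D
          (fun pp x => haveI : Fact (pp : ℕ).Prime := ⟨pp.2⟩; ramIdx T.K (placeOf (pilotDataOfK T.D T.K) pp.1 x)) n₀ lam
          (fun pp i w => ((((i : ℕ) : ℤ) + 1) ^ 2) * mq pp w) mq) := by
  letI := T.instFieldF; letI := T.instNumberFieldF; letI := T.instAlgebraF; letI := T.instFieldK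
  letI := T.instNumberFieldK; letI := T.instAlgebraK; letI := T.instFieldFbar; letI := T.instAlgebraFbar
  letI := T.instAlgebraKFbar; letI := T.instIsElliptic
  exact frey13_not_of_door T fun M _ _ archPk archSub Ψ act Mmod region frobAdm frobLogvol frobΨ frobMmod unitImage ballImage thetaDiv n _ _ _ lat
      _ _ _ _ _ _ _ _ sig split _ _ _ qData qK h => by
    obtain ⟨n₀, lam, mq, hn₀, hlam, hmq, hH⟩ := h
    exact pilotKummerCompatHull_chosen_of_slotReachWindowK T.D M archPk archSub Ψ act Mmod region frobAdm frobLogvol frobΨ frobMmod unitImage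
      ballImage thetaDiv n lat sig split qData qK n₀ lam mq hn₀ hlam hmq hH

/-- **OFF Σ₈**: no genuine datum over `(ratPoint λ, 13)` satisfies abc-iut-rp-m2's `RHHeightClass.HBand (pilotDataOfK T.D T.K)` — the conclusion of `hSigma8Bad`
(p476057) at `T`, VERBATIM; door p470562 `pilotKummerCompatHull_chosen_of_hBand`. [cite: DupuyHilado2025, §3.9, §4.9] [claim: Mochizuki2012, status: disputed] -/
theorem frey13_not_hBand
    (T : Cor22.ThetaVolumeDatumAt (ratPoint (((2 * 5 ^ 10 * 13 ^ 4 : ℕ) : ℚ) / (11 ^ 8 * 109 ^ 2 * 3677 ^ 3 : ℕ))) 13) :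
    letI := T.instFieldF; letI := T.instNumberFieldF; letI := T.instAlgebraF; letI := T.instFieldK
    letI := T.instNumberFieldK; letI := T.instAlgebraK; letI := T.instFieldFbar; letI := T.instAlgebraFbar
    letI := T.instAlgebraKFbar; letI := T.instIsElliptic
    ¬ RHHeightClass.HBand (pilotDataOfK T.D T.K) := by
  letI := T.instFieldF; letI := T.instNumberFieldF; letI := T.instAlgebraF; letI := T.instFieldK
  letI := T.instNumberFieldK; letI := T.instAlgebraK; letI := T.instFieldFbar; letI := T.instAlgebraFbar
  letI := T.instAlgebraKFbar; letI := T.instIsElliptic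
  exact frey13_not_of_door T fun M _ _ archPk archSub Ψ act Mmod region frobAdm frobLogvol frobΨ frobMmod unitImage ballImage thetaDiv n _ _ _ lat
      _ _ _ _ _ _ _ _ sig split _ _ _ qData qK h =>
    pilotKummerCompatHull_chosen_of_hBand T.D M archPk archSub Ψ act Mmod region frobAdm frobLogvol frobΨ frobMmod unitImage ballImage thetaDiv n
      lat sig split qData qK h

/-- **OFF Σ₁₈**: no genuine datum over `(ratPoint λ, 13)` satisfies abc-iut-rh2-xi-2's `InSigma18 T.D t_q t_Θ` at the CHOSEN realising ideles — the conclusion of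
`hSigma18Bad` (p476057) at `T`, VERBATIM; door p471359 `pilotKummerCompatHull_chosen_of_inSigma18`. [cite: DupuyHilado2025, §3.9, §4.9] [claim: Mochizuki2012, status: disputed] -/
theorem frey13_not_inSigma18
    (T : Cor22.ThetaVolumeDatumAt (ratPoint (((2 * 5 ^ 10 * 13 ^ 4 : ℕ) : ℚ) / (11 ^ 8 * 109 ^ 2 * 3677 ^ 3 : ℕ))) 13) :
    letI := T.instFieldF; letI := T.instNumberFieldF; letI := T.instAlgebraF; letI := T.instFieldK
    letI := T.instNumberFieldK; letI := T.instAlgebraK; letI := T.instFieldFbar; letI := T.instAlgebraFbar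
    letI := T.instAlgebraKFbar; letI := T.instIsElliptic
    ¬ InSigma18 T.D (exists_realising_qIdeles_pilotDataOfK T.D).choose (exists_realising_thetaIdeles_pilotDataOfK T.D).choose := by
  letI := T.instFieldF; letI := T.instNumberFieldF; letI := T.instAlgebraF; letI := T.instFieldK
  letI := T.instNumberFieldK; letI := T.instAlgebraK; letI := T.instFieldFbar; letI := T.instAlgebraFbar
  letI := T.instAlgebraKFbar; letI := T.instIsElliptic
  exact frey13_not_of_door T fun M _ _ archPk archSub Ψ act Mmod region frobAdm frobLogvol frobΨ frobMmod unitImage ballImage thetaDiv n _ _ _ lat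
      _ _ _ _ _ _ _ _ sig split _ _ _ qData qK h =>
    pilotKummerCompatHull_chosen_of_inSigma18 T.D M archPk archSub Ψ act Mmod region frobAdm frobLogvol frobΨ frobMmod unitImage ballImage
      thetaDiv n lat sig split qData qK h

/-- **OFF Σ₁₆ (side-condition typing)**: no genuine datum over `(ratPoint λ, 13)` satisfies «`hside` ∧ `DiffPriced.HStarDiffPriced T.D`» — the conclusion of
`hSigma16Bad` (p476057) at `T`, VERBATIM; door p472572 `pilotKummerCompatHull_chosen_of_hStarDiffPriced`. [cite: DupuyHilado2025, §3.9, §4.9] [claim: Mochizuki2012, status: disputed] -/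
theorem frey13_not_hside_hStarDiffPriced
    (T : Cor22.ThetaVolumeDatumAt (ratPoint (((2 * 5 ^ 10 * 13 ^ 4 : ℕ) : ℚ) / (11 ^ 8 * 109 ^ 2 * 3677 ^ 3 : ℕ))) 13) :
    letI := T.instFieldF; letI := T.instNumberFieldF; letI := T.instAlgebraF; letI := T.instFieldK
    letI := T.instNumberFieldK; letI := T.instAlgebraK; letI := T.instFieldFbar; letI := T.instAlgebraFbar
    letI := T.instAlgebraKFbar; letI := T.instIsElliptic
    ¬ ((∀ (pp : Nat.Primes) (w : (thetaIndex (pilotDataOfK T.D T.K)).Fibre (.inr pp)), haveI : Fact (pp : ℕ).Prime := ⟨pp.2⟩;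
        placeOf (pilotDataOfK T.D T.K) pp.1 w ∈ (pilotDataOfK T.D T.K).S →
          2 < (pp : ℕ) ∧
          (∀ x : (thetaIndex (pilotDataOfK T.D T.K)).Fibre (.inr pp),
            ramIdx T.K (placeOf (pilotDataOfK T.D T.K) pp.1 x) = ramIdx T.K (placeOf (pilotDataOfK T.D T.K) pp.1 w)) ∧
          ¬ (pp : ℕ) ∣ ramIdx T.K (placeOf (pilotDataOfK T.D T.K) pp.1 w) ∧
          ∃ r : ℤ, RHHeightClass.StrictMinPow (pp : ℕ) (ramIdx T.K (placeOf (pilotDataOfK T.D T.K) pp.1 w)) r) ∧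
      DiffPriced.HStarDiffPriced T.D) := by
  letI := T.instFieldF; letI := T.instNumberFieldF; letI := T.instAlgebraF; letI := T.instFieldK
  letI := T.instNumberFieldK; letI := T.instAlgebraK; letI := T.instFieldFbar; letI := T.instAlgebraFbar
  letI := T.instAlgebraKFbar; letI := T.instIsElliptic
  exact frey13_not_of_door T fun M _ _ archPk archSub Ψ act Mmod region frobAdm frobLogvol frobΨ frobMmod unitImage ballImage thetaDiv n _ _ _ lat
      _ _ _ _ _ _ _ _ sig split _ _ _ qData qK h =>
    pilotKummerCompatHull_chosen_of_hStarDiffPriced T.D M archPk archSub Ψ act Mmod region frobAdm frobLogvol frobΨ frobMmod unitImage ballImage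
      thetaDiv n lat sig split qData qK h.1 h.2

/-- **OFF Σ₁₆ (datum-class typing)**: no genuine datum over `(ratPoint λ, 13)` satisfies abc-iut-rh2-xi-2's `InSigma16 T.D e_K B_K` — the conclusion of
`hInSigma16Bad` (p476262) at `T`, VERBATIM; door p476262 `pilotKummerCompatHull_chosen_of_inSigma16`. [cite: DupuyHilado2025, §3.9, §4.9] [claim: Mochizuki2012, status: disputed] -/
theorem frey13_not_inSigma16
    (T : Cor22.ThetaVolumeDatumAt (ratPoint (((2 * 5 ^ 10 * 13 ^ 4 : ℕ) : ℚ) / (11 ^ 8 * 109 ^ 2 * 3677 ^ 3 : ℕ))) 13) :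
    letI := T.instFieldF; letI := T.instNumberFieldF; letI := T.instAlgebraF; letI := T.instFieldK
    letI := T.instNumberFieldK; letI := T.instAlgebraK; letI := T.instFieldFbar; letI := T.instAlgebraFbar
    letI := T.instAlgebraKFbar; letI := T.instIsElliptic
    ¬ (∃ (eK : Nat.Primes → ℕ) (BK : Nat.Primes → ℤ), InSigma16 T.D eK BK) := by
  letI := T.instFieldF; letI := T.instNumberFieldF; letI := T.instAlgebraF; letI := T.instFieldK
  letI := T.instNumberFieldK; letI := T.instAlgebraK; letI := T.instFieldFbar; letI := T.instAlgebraFbar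
  letI := T.instAlgebraKFbar; letI := T.instIsElliptic
  exact frey13_not_of_door T fun M _ _ archPk archSub Ψ act Mmod region frobAdm frobLogvol frobΨ frobMmod unitImage ballImage thetaDiv n _ _ _ lat
      _ _ _ _ _ _ _ _ sig split _ _ _ qData qK h => by
    obtain ⟨eK, BK, h⟩ := h
    exact pilotKummerCompatHull_chosen_of_inSigma16 T.D M archPk archSub Ψ act Mmod region frobAdm frobLogvol frobΨ frobMmod unitImage ballImage
      thetaDiv n lat sig split qData qK h

/-! ## §2. GENERIC: a datum class missing the tier-1 Frey–Legendre data cannot carry the stratum binder of the window-shape certificate -/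

/-- **`¬ hSigmaBad` FOR EVERY DATUM CLASS THAT MISSES THE TIER-1 FREY–LEGENDRE DATA.** For an ARBITRARY `InSig` containing no genuine datum over `(ratPoint λ, 13)`,
the stratum binder `hSigmaBad` of `abc_of_inSigma_v10K_window_szpiroBadAll` (p475597) — TYPE VERBATIM — is FALSE: `(ratPoint λ, 13)` is admissible AS TYPED
(`Conditional.FreyTier1.mem_UP/.admitsCore/.condP2/.condP5`, the THEOREM `Conditional.condP6_thirteen`), Szpiro-bad AS TYPED (`.szpiroBad`), every genuine datum
over it is shallow (`.not_deep`), the datum type is inhabited (`.nonempty_thetaVolumeDatumAt`). [cite: Mochizuki2012, IUTchIV Thm. 1.10 p. 22–23, Cor. 2.2 (ii) p. 43–46] [claim: Mochizuki2012, status: disputed] -/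
theorem not_hSigmaBad_of_forall_not_frey13
    (InSig : ∀ (P : NFPoint) (l : ℕ), Cor22.ThetaVolumeDatumAt P l → Prop)
    (hfrey : ∀ T : Cor22.ThetaVolumeDatumAt (ratPoint (((2 * 5 ^ 10 * 13 ^ 4 : ℕ) : ℚ) / (11 ^ 8 * 109 ^ 2 * 3677 ^ 3 : ℕ))) 13,
      ¬ InSig _ 13 T) :
    ¬ (∀ (P : NFPoint), P ∈ UP → ∀ (l : ℕ), l.Prime → 5 ≤ l →
      Cor22.AdmitsCore P → Cor22.CondP2 P l → Cor22.CondP5 P l → Cor22.CondP6 P l →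
      -- ONLY at SZPIRO-BAD `(P, l)`: elsewhere `T.Cor312Of` is the theorem `Cor22.ThetaVolumeDatumAt.cor312Of_of_szpiro` (abc-iut-c312-d1)
      (((l : ℝ) + 5) / 4 < (Cor22.dmod P : ℝ) ∨
        6 * l * (((l : ℝ) + 5) - 4 * Cor22.dmod P) / (((l : ℝ) + 4) * ((l : ℝ) - 3))
            * (P.logDiff + (1 - 1 / (l : ℝ)) * Cor22.logCondAvoid P {2, l})
          + 6 * l * ((l : ℝ) + 5) / (((l : ℝ) + 4) * ((l : ℝ) - 3)) * Real.log Real.pi < Cor22.logQAvoid P {2, l}) →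
      ∀ (T : Cor22.ThetaVolumeDatumAt P l), letI := T.instFieldF; letI := T.instNumberFieldF; letI := T.instAlgebraF; letI := T.instFieldK;
        letI := T.instNumberFieldK; letI := T.instAlgebraK; letI := T.instFieldFbar; letI := T.instAlgebraFbar;
        letI := T.instAlgebraKFbar; letI := T.instIsElliptic;
      ¬ (∃ (pp : Nat.Primes) (_ : 2 < (pp : ℕ)) (i : Fin (thetaIndex (pilotDataOfK T.D T.K)).lstar)
          (x₀ : (thetaIndex (pilotDataOfK T.D T.K)).Fibre (.inr pp)),
        haveI : Fact (pp : ℕ).Prime := ⟨pp.2⟩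
        ((pp : ℕ) : ℝ) ^ ((((i : ℕ) : ℝ) + 2) * (4 + 2 * Real.logb (pp : ℕ) (Module.finrank ℚ T.K)) + 1) *
          ‖(exists_realising_qIdeles_pilotDataOfK T.D).choose pp x₀‖ ^ (((i : ℕ) + 1) ^ 2 - 1) < 1) →
      InSig P l T) := by
  intro hS
  obtain ⟨T⟩ := Conditional.FreyTier1.nonempty_thetaVolumeDatumAt Conditional.condP6_thirteen
  exact hfrey T (hS _ Conditional.FreyTier1.mem_UP 13 (by norm_num) (by norm_num) Conditional.FreyTier1.admitsCore
    Conditional.FreyTier1.condP2 Conditional.FreyTier1.condP5 Conditional.condP6_thirteen Conditional.FreyTier1.szpiroBad T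
    (Conditional.FreyTier1.not_deep T))

/-! ## §3. The five Σ-binders of the window-shape re-cut certificates are FALSE — unconditionally -/

/-- **`¬ hSigma15Bad` (row 15, slot-reach window Σ₁₅)** — the stratum binder of `abc_of_sigma15_v10K_window_szpiroBadAll` (p475597), TYPE VERBATIM, is FALSE
(§2 at `frey13_not_inSigma15`): that certificate is VACUOUS AS TYPED; successor shape `abc_of_inSigma_orNum_K_szpiroBad_hregBad`, whose off-Σ binder — ENGAGED
at `(ratPoint λ, 13)` by §1 — is neither proved nor refuted as typed. No side taken on [IUTchIII] Cor. 3.12. [cite: DupuyHilado2025, §3.9, §4.9] [claim: Mochizuki2012, status: disputed] -/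
theorem not_hSigma15Bad :
    ¬ (∀ (P : NFPoint), P ∈ UP → ∀ (l : ℕ), l.Prime → 5 ≤ l →
      Cor22.AdmitsCore P → Cor22.CondP2 P l → Cor22.CondP5 P l → Cor22.CondP6 P l →
      -- ONLY at SZPIRO-BAD `(P, l)`: elsewhere `T.Cor312Of` is the theorem `Cor22.ThetaVolumeDatumAt.cor312Of_of_szpiro` (abc-iut-c312-d1)
      (((l : ℝ) + 5) / 4 < (Cor22.dmod P : ℝ) ∨
        6 * l * (((l : ℝ) + 5) - 4 * Cor22.dmod P) / (((l : ℝ) + 4) * ((l : ℝ) - 3))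
            * (P.logDiff + (1 - 1 / (l : ℝ)) * Cor22.logCondAvoid P {2, l})
          + 6 * l * ((l : ℝ) + 5) / (((l : ℝ) + 4) * ((l : ℝ) - 3)) * Real.log Real.pi < Cor22.logQAvoid P {2, l}) →
      ∀ (T : Cor22.ThetaVolumeDatumAt P l), letI := T.instFieldF; letI := T.instNumberFieldF; letI := T.instAlgebraF; letI := T.instFieldK;
        letI := T.instNumberFieldK; letI := T.instAlgebraK; letI := T.instFieldFbar; letI := T.instAlgebraFbar;
        letI := T.instAlgebraKFbar; letI := T.instIsElliptic;
      ¬ (∃ (pp : Nat.Primes) (_ : 2 < (pp : ℕ)) (i : Fin (thetaIndex (pilotDataOfK T.D T.K)).lstar)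
          (x₀ : (thetaIndex (pilotDataOfK T.D T.K)).Fibre (.inr pp)),
        haveI : Fact (pp : ℕ).Prime := ⟨pp.2⟩
        ((pp : ℕ) : ℝ) ^ ((((i : ℕ) : ℝ) + 2) * (4 + 2 * Real.logb (pp : ℕ) (Module.finrank ℚ T.K)) + 1) *
          ‖(exists_realising_qIdeles_pilotDataOfK T.D).choose pp x₀‖ ^ (((i : ℕ) + 1) ^ 2 - 1) < 1) →
      ∃ (n₀ : ∀ pp : Nat.Primes, (thetaIndex (pilotDataOfK T.D T.K)).Fibre (.inr pp) → ℕ)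
        (lam : ∀ pp : Nat.Primes, (thetaIndex (pilotDataOfK T.D T.K)).Fibre (.inr pp) → ℝ)
        (mq : ∀ pp : Nat.Primes, (thetaIndex (pilotDataOfK T.D T.K)).Fibre (.inr pp) → ℤ),
        (∀ (pp : Nat.Primes) (x : (thetaIndex (pilotDataOfK T.D T.K)).Fibre (.inr pp)), haveI : Fact (pp : ℕ).Prime := ⟨pp.2⟩;
          ∃ u : kOf (pilotDataOfK T.D T.K) pp.1 x,
            ‖u‖ ≤ (pp : ℝ) ^ (-(((n₀ pp x : ℤ) - 1 : ℤ) : ℝ) / (ramIdx T.K (placeOf (pilotDataOfK T.D T.K) pp.1 x) : ℝ)) ∧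
              u ∉ (logUnits (kOf (pilotDataOfK T.D T.K) pp.1 x) : Set (kOf (pilotDataOfK T.D T.K) pp.1 x))) ∧
        (∀ (pp : Nat.Primes) (x : (thetaIndex (pilotDataOfK T.D T.K)).Fibre (.inr pp)), haveI : Fact (pp : ℕ).Prime := ⟨pp.2⟩;
          ∃ z ∈ (logUnits (kOf (pilotDataOfK T.D T.K) pp.1 x) : Set (kOf (pilotDataOfK T.D T.K) pp.1 x)), (pp : ℝ) ^ (lam pp x) ≤ ‖z‖) ∧
        (∀ (pp : Nat.Primes) (w : (thetaIndex (pilotDataOfK T.D T.K)).Fibre (.inr pp)), haveI : Fact (pp : ℕ).Prime := ⟨pp.2⟩;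
          placeOf (pilotDataOfK T.D T.K) pp.1 w ∈ (pilotDataOfK T.D T.K).S →
            (mq pp w : ℝ) = (pilotDataOfK T.D T.K).qPilot (placeOf (pilotDataOfK T.D T.K) pp.1 w)) ∧
        SlotReachWindowK T.D
          (fun pp x => haveI : Fact (pp : ℕ).Prime := ⟨pp.2⟩; ramIdx T.K (placeOf (pilotDataOfK T.D T.K) pp.1 x)) n₀ lam
          (fun pp i w => ((((i : ℕ) : ℤ) + 1) ^ 2) * mq pp w) mq) :=
  not_hSigmaBad_of_forall_not_frey13 _ fun T => frey13_not_inSigma15 T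

/-- **`¬ hSigma8Bad` (row 8, height-class band Σ₈)** — the stratum binder of `abc_of_hBand_v10K_window_szpiroBadAll` (p476057), TYPE VERBATIM, is FALSE (§2 at
`frey13_not_hBand`): that certificate is VACUOUS AS TYPED; successor shape = the orNum generic at `InSig := HBand (pilotDataOfK T.D T.K)`; `HBand` stays a
HYPOTHESIS SHAPE elsewhere. No side taken on [IUTchIII] Cor. 3.12. [cite: DupuyHilado2025, §3.9, §4.9] [claim: Mochizuki2012, status: disputed] -/
theorem not_hSigma8Bad :
    ¬ (∀ (P : NFPoint), P ∈ UP → ∀ (l : ℕ), l.Prime → 5 ≤ l →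
      Cor22.AdmitsCore P → Cor22.CondP2 P l → Cor22.CondP5 P l → Cor22.CondP6 P l →
      -- ONLY at SZPIRO-BAD `(P, l)`: elsewhere `T.Cor312Of` is the theorem `Cor22.ThetaVolumeDatumAt.cor312Of_of_szpiro` (abc-iut-c312-d1)
      (((l : ℝ) + 5) / 4 < (Cor22.dmod P : ℝ) ∨
        6 * l * (((l : ℝ) + 5) - 4 * Cor22.dmod P) / (((l : ℝ) + 4) * ((l : ℝ) - 3))
            * (P.logDiff + (1 - 1 / (l : ℝ)) * Cor22.logCondAvoid P {2, l})
          + 6 * l * ((l : ℝ) + 5) / (((l : ℝ) + 4) * ((l : ℝ) - 3)) * Real.log Real.pi < Cor22.logQAvoid P {2, l}) →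
      ∀ (T : Cor22.ThetaVolumeDatumAt P l), letI := T.instFieldF; letI := T.instNumberFieldF; letI := T.instAlgebraF; letI := T.instFieldK;
        letI := T.instNumberFieldK; letI := T.instAlgebraK; letI := T.instFieldFbar; letI := T.instAlgebraFbar;
        letI := T.instAlgebraKFbar; letI := T.instIsElliptic;
      ¬ (∃ (pp : Nat.Primes) (_ : 2 < (pp : ℕ)) (i : Fin (thetaIndex (pilotDataOfK T.D T.K)).lstar)
          (x₀ : (thetaIndex (pilotDataOfK T.D T.K)).Fibre (.inr pp)),
        haveI : Fact (pp : ℕ).Prime := ⟨pp.2⟩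
        ((pp : ℕ) : ℝ) ^ ((((i : ℕ) : ℝ) + 2) * (4 + 2 * Real.logb (pp : ℕ) (Module.finrank ℚ T.K)) + 1) *
          ‖(exists_realising_qIdeles_pilotDataOfK T.D).choose pp x₀‖ ^ (((i : ℕ) + 1) ^ 2 - 1) < 1) →
      RHHeightClass.HBand (pilotDataOfK T.D T.K)) :=
  not_hSigmaBad_of_forall_not_frey13 _ fun T => frey13_not_hBand T

/-- **`¬ hSigma18Bad` (row 18, lattice level window Σ₁₈)** — the stratum binder of `abc_of_inSigma18_v10K_window_szpiroBadAll` (p476057), TYPE VERBATIM, is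
FALSE (§2 at `frey13_not_inSigma18`): that certificate is VACUOUS AS TYPED; successor shape = the orNum generic at `InSig := InSigma18 T.D t_q t_Θ`; `InSigma18`
stays a HYPOTHESIS SHAPE elsewhere. No side taken on [IUTchIII] Cor. 3.12. [cite: DupuyHilado2025, §3.9, §4.9] [claim: Mochizuki2012, status: disputed] -/
theorem not_hSigma18Bad :
    ¬ (∀ (P : NFPoint), P ∈ UP → ∀ (l : ℕ), l.Prime → 5 ≤ l →
      Cor22.AdmitsCore P → Cor22.CondP2 P l → Cor22.CondP5 P l → Cor22.CondP6 P l →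
      -- ONLY at SZPIRO-BAD `(P, l)`: elsewhere `T.Cor312Of` is the theorem `Cor22.ThetaVolumeDatumAt.cor312Of_of_szpiro` (abc-iut-c312-d1)
      (((l : ℝ) + 5) / 4 < (Cor22.dmod P : ℝ) ∨
        6 * l * (((l : ℝ) + 5) - 4 * Cor22.dmod P) / (((l : ℝ) + 4) * ((l : ℝ) - 3))
            * (P.logDiff + (1 - 1 / (l : ℝ)) * Cor22.logCondAvoid P {2, l})
          + 6 * l * ((l : ℝ) + 5) / (((l : ℝ) + 4) * ((l : ℝ) - 3)) * Real.log Real.pi < Cor22.logQAvoid P {2, l}) →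
      ∀ (T : Cor22.ThetaVolumeDatumAt P l), letI := T.instFieldF; letI := T.instNumberFieldF; letI := T.instAlgebraF; letI := T.instFieldK;
        letI := T.instNumberFieldK; letI := T.instAlgebraK; letI := T.instFieldFbar; letI := T.instAlgebraFbar;
        letI := T.instAlgebraKFbar; letI := T.instIsElliptic;
      ¬ (∃ (pp : Nat.Primes) (_ : 2 < (pp : ℕ)) (i : Fin (thetaIndex (pilotDataOfK T.D T.K)).lstar)
          (x₀ : (thetaIndex (pilotDataOfK T.D T.K)).Fibre (.inr pp)),
        haveI : Fact (pp : ℕ).Prime := ⟨pp.2⟩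
        ((pp : ℕ) : ℝ) ^ ((((i : ℕ) : ℝ) + 2) * (4 + 2 * Real.logb (pp : ℕ) (Module.finrank ℚ T.K)) + 1) *
          ‖(exists_realising_qIdeles_pilotDataOfK T.D).choose pp x₀‖ ^ (((i : ℕ) + 1) ^ 2 - 1) < 1) →
      InSigma18 T.D (exists_realising_qIdeles_pilotDataOfK T.D).choose (exists_realising_thetaIdeles_pilotDataOfK T.D).choose) :=
  not_hSigmaBad_of_forall_not_frey13 _ fun T => frey13_not_inSigma18 T

/-- **`¬ hSigma16Bad` (row 16, different-priced cells Σ₁₆ with side conditions)** — the stratum binder of `abc_of_sigma16_v10K_window_szpiroBadAll` (p476057),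
TYPE VERBATIM, is FALSE (§2 at `frey13_not_hside_hStarDiffPriced`): that certificate is VACUOUS AS TYPED; successor shape = the orNum generic at the same class;
`HStarDiffPriced` stays a HYPOTHESIS SHAPE elsewhere. No side taken on [IUTchIII] Cor. 3.12. [cite: DupuyHilado2025, §3.9, §4.9] [claim: Mochizuki2012, status: disputed] -/
theorem not_hSigma16Bad :
    ¬ (∀ (P : NFPoint), P ∈ UP → ∀ (l : ℕ), l.Prime → 5 ≤ l →
      Cor22.AdmitsCore P → Cor22.CondP2 P l → Cor22.CondP5 P l → Cor22.CondP6 P l →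
      -- ONLY at SZPIRO-BAD `(P, l)`: elsewhere `T.Cor312Of` is the theorem `Cor22.ThetaVolumeDatumAt.cor312Of_of_szpiro` (abc-iut-c312-d1)
      (((l : ℝ) + 5) / 4 < (Cor22.dmod P : ℝ) ∨
        6 * l * (((l : ℝ) + 5) - 4 * Cor22.dmod P) / (((l : ℝ) + 4) * ((l : ℝ) - 3))
            * (P.logDiff + (1 - 1 / (l : ℝ)) * Cor22.logCondAvoid P {2, l})
          + 6 * l * ((l : ℝ) + 5) / (((l : ℝ) + 4) * ((l : ℝ) - 3)) * Real.log Real.pi < Cor22.logQAvoid P {2, l}) →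
      ∀ (T : Cor22.ThetaVolumeDatumAt P l), letI := T.instFieldF; letI := T.instNumberFieldF; letI := T.instAlgebraF; letI := T.instFieldK;
        letI := T.instNumberFieldK; letI := T.instAlgebraK; letI := T.instFieldFbar; letI := T.instAlgebraFbar;
        letI := T.instAlgebraKFbar; letI := T.instIsElliptic;
      ¬ (∃ (pp : Nat.Primes) (_ : 2 < (pp : ℕ)) (i : Fin (thetaIndex (pilotDataOfK T.D T.K)).lstar)
          (x₀ : (thetaIndex (pilotDataOfK T.D T.K)).Fibre (.inr pp)),
        haveI : Fact (pp : ℕ).Prime := ⟨pp.2⟩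
        ((pp : ℕ) : ℝ) ^ ((((i : ℕ) : ℝ) + 2) * (4 + 2 * Real.logb (pp : ℕ) (Module.finrank ℚ T.K)) + 1) *
          ‖(exists_realising_qIdeles_pilotDataOfK T.D).choose pp x₀‖ ^ (((i : ℕ) + 1) ^ 2 - 1) < 1) →
      (∀ (pp : Nat.Primes) (w : (thetaIndex (pilotDataOfK T.D T.K)).Fibre (.inr pp)), haveI : Fact (pp : ℕ).Prime := ⟨pp.2⟩;
        placeOf (pilotDataOfK T.D T.K) pp.1 w ∈ (pilotDataOfK T.D T.K).S →
          2 < (pp : ℕ) ∧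
          (∀ x : (thetaIndex (pilotDataOfK T.D T.K)).Fibre (.inr pp),
            ramIdx T.K (placeOf (pilotDataOfK T.D T.K) pp.1 x) = ramIdx T.K (placeOf (pilotDataOfK T.D T.K) pp.1 w)) ∧
          ¬ (pp : ℕ) ∣ ramIdx T.K (placeOf (pilotDataOfK T.D T.K) pp.1 w) ∧
          ∃ r : ℤ, RHHeightClass.StrictMinPow (pp : ℕ) (ramIdx T.K (placeOf (pilotDataOfK T.D T.K) pp.1 w)) r) ∧
      DiffPriced.HStarDiffPriced T.D) :=
  not_hSigmaBad_of_forall_not_frey13 _ fun T => frey13_not_hside_hStarDiffPriced T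

/-- **`¬ hInSigma16Bad` (row 16 BY NAME of `InSigma16`)** — the stratum binder of `abc_of_inSigma16_v10K_window_szpiroBadAll` (p476262), TYPE VERBATIM, is FALSE
(§2 at `frey13_not_inSigma16`): that certificate is VACUOUS AS TYPED; successor shape = the orNum generic at `InSig := ∃ e_K B_K, InSigma16 T.D e_K B_K`;
`InSigma16` stays a HYPOTHESIS SHAPE elsewhere. No side taken on [IUTchIII] Cor. 3.12. [cite: DupuyHilado2025, §3.9, §4.9] [claim: Mochizuki2012, status: disputed] -/
theorem not_hInSigma16Bad :
    ¬ (∀ (P : NFPoint), P ∈ UP → ∀ (l : ℕ), l.Prime → 5 ≤ l →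
      Cor22.AdmitsCore P → Cor22.CondP2 P l → Cor22.CondP5 P l → Cor22.CondP6 P l →
      -- ONLY at SZPIRO-BAD `(P, l)`: elsewhere `T.Cor312Of` is the theorem `Cor22.ThetaVolumeDatumAt.cor312Of_of_szpiro` (abc-iut-c312-d1)
      (((l : ℝ) + 5) / 4 < (Cor22.dmod P : ℝ) ∨
        6 * l * (((l : ℝ) + 5) - 4 * Cor22.dmod P) / (((l : ℝ) + 4) * ((l : ℝ) - 3))
            * (P.logDiff + (1 - 1 / (l : ℝ)) * Cor22.logCondAvoid P {2, l})
          + 6 * l * ((l : ℝ) + 5) / (((l : ℝ) + 4) * ((l : ℝ) - 3)) * Real.log Real.pi < Cor22.logQAvoid P {2, l}) →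
      ∀ (T : Cor22.ThetaVolumeDatumAt P l), letI := T.instFieldF; letI := T.instNumberFieldF; letI := T.instAlgebraF; letI := T.instFieldK;
        letI := T.instNumberFieldK; letI := T.instAlgebraK; letI := T.instFieldFbar; letI := T.instAlgebraFbar;
        letI := T.instAlgebraKFbar; letI := T.instIsElliptic;
      ¬ (∃ (pp : Nat.Primes) (_ : 2 < (pp : ℕ)) (i : Fin (thetaIndex (pilotDataOfK T.D T.K)).lstar)
          (x₀ : (thetaIndex (pilotDataOfK T.D T.K)).Fibre (.inr pp)),
        haveI : Fact (pp : ℕ).Prime := ⟨pp.2⟩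
        ((pp : ℕ) : ℝ) ^ ((((i : ℕ) : ℝ) + 2) * (4 + 2 * Real.logb (pp : ℕ) (Module.finrank ℚ T.K)) + 1) *
          ‖(exists_realising_qIdeles_pilotDataOfK T.D).choose pp x₀‖ ^ (((i : ℕ) + 1) ^ 2 - 1) < 1) →
      ∃ (eK : Nat.Primes → ℕ) (BK : Nat.Primes → ℤ), InSigma16 T.D eK BK) :=
  not_hSigmaBad_of_forall_not_frey13 _ fun T => frey13_not_inSigma16 T

end Summit.ABC.IUTFork.Repair.RH2SigmaHull

end
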